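import Summits.RiemannHypothesis.RiemannHypothesis.Theses.RuelleBand
import Summits.RiemannHypothesis.RiemannHypothesis.Theorems.RuelleBandExactFirstBandStubEvenSymTranslate
import Summits.RiemannHypothesis.RiemannHypothesis.Theorems.RuelleBandExactFirstBandStubEvenExpSum
import Summits.RiemannHypothesis.RiemannHypothesis.Theorems.RuelleBandExactFirstBandStubEvenEngine
import Summits.RiemannHypothesis.RiemannHypothesis.Theorems.RuelleBandExactFirstBandStubEvenTestExists
import Summits.RiemannHypothesis.RiemannHypothesis.Theorems.RuelleBandExactFirstBandStubEvenTransfer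
import HarnessLib.Audit

/-! # Line `SketchIdeator1`: the ODD-sector companion — Weil positivity on odd real tests also forces X

Crux `RuelleBand.ExactFirstBand` (stmt-RiemannHypothesis-2061), line `SketchIdeator1`, stub
`stub_oddSectorCriterion`.  The line has landed the EVEN-sector Weil criterion
(`stub_evenTransfer`: `0 ≤ Re W(g ⋆ g̃)` for all even real-valued test `g` ⟹ every zero of `ζ` with
`0 < Re < 1` is on the critical line or the real axis).  This file proves the ODD-sector companion by the
same engine: positivity on all ODD real-valued test functions also forces the conclusion.

For an odd `g` (`g(-t) = -g(t)`), in the additive `1/2`-symmetric normalisation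
`ĝ(s) = ∫ g(t) e^{(s-1/2)t} dt`:

* `ĝ(1 - s) = -ĝ(s)` (substitute `t ↦ -t`; `weilMellin_one_sub_of_odd`), and for real-valued `g`,
  `conj ĝ(s) = ĝ(s̄)` (`conj_weilMellin_of_real`); hence the zero-side coefficient is MINUS a square,
  `P_g(ρ) = ĝ(ρ) conj ĝ(1 - ρ̄) = -ĝ(ρ)²` (`pairCoeff_of_odd_real`), while still `P_g(1 - ρ) = P_g(ρ)`
  (the two signs cancel, `pairCoeff_one_sub_of_odd`), so `B_g = WeilConverse.expSum g` is again even and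
  real (`expSum_neg_of_odd`, `expSum_im_of_odd`);
* the symmetric translate `h_x = (g(· - x) + g(· + x))/2` of an odd `g` is odd (`symTranslate_odd`), a
  test function and real-valued (`stub_evenSymTranslate`), so the odd-sector bet applies to `h_{x/2}` and,
  via `Q₀(h_x) = (Re B_g(2x) + Q₀(g))/2` (`zeroForm_symTranslate`) and `Q₀(h) = W(h ⋆ h̃)` (explicit
  formula), gives the ONE-SIDED bound `Re B_g(x) ≥ -Re Q₀(g)` (`oddSector_lowerBound`);
* THE ENGINE (`stub_evenEngine`, through `stub_evenTransfer_order_mul_pairCoeff_eq_zero`) kills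
  `m(ρ) P_g(ρ) = -m(ρ) ĝ(ρ)²` at every non-trivial zero with `Re ρ > 1/2`; zeros with `Re ρ < 1/2`
  reflect to `1 - ρ̄` (`ĝ(1 - ρ̄) = -conj ĝ(ρ)`), so `ĝ` vanishes at every off-line non-trivial zero
  for every odd real test `g` (`oddSector_weilMellin_eq_zero`);
* but for `ρ ≠ 1/2` the DERIVATIVE `g = g₀'` of the even real bump `g₀` of `stub_evenTestExists ρ` is an
  odd real test function with `ĝ(ρ) = -(ρ - 1/2) ĝ₀(ρ) ≠ 0` (`weilMellin_deriv`;
  `exists_odd_real_isWeilTest_weilMellin_ne_zero`).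

References: E. Bombieri, *Remarks on Weil's quadratic functional in the theory of prime numbers I*,
Rend. Lincei (9) 11 (2000), 183–233, §3 Thm. 1; A. Weil, *Sur les "formules explicites" de la théorie
des nombres premiers* (1952).
-/

noncomputable section
open Complex MeasureTheory Filter Set
open scoped Real Topology ComplexConjugate
namespace Summit.RiemannHypothesis.RiemannHypothesis.Theorems.RuelleBandExactFirstBand
open Literature.NumberTheory.LFunctions

/-- **Oddness of the transform.** For an odd `g`, `ĝ(1 - s) = -ĝ(s)` for every `s : ℂ`: substitute
`t ↦ -t` (`integral_neg_eq_self`) and use `g(-t) = -g(t)`, `(1 - s - 1/2)(-t) = (s - 1/2)t`.  No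
hypotheses on `g` beyond oddness (both sides are junk together). [folklore] -/
theorem weilMellin_one_sub_of_odd {g : ℝ → ℂ} (hodd : ∀ t : ℝ, g (-t) = -g t) (s : ℂ) :
    weilMellin g (1 - s) = -weilMellin g s := by
  -- adapted from `weilMellin_one_sub_of_even` (…StubEvenExpSum.lean)
  unfold weilMellin
  have h := integral_neg_eq_self
    (fun t : ℝ ↦ g (-t) * cexp ((1 - s - 1 / 2) * ((-t : ℝ) : ℂ))) volume
  simp only [neg_neg] at h
  rw [h, ← integral_neg]
  congr 1 with t
  rw [hodd t, neg_mul]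
  congr 2
  push_cast
  ring

/-- **Realness of the transform.** For a real-valued `g`, `conj ĝ(s) = ĝ(conj s)` (conjugation
commutes with the Bochner integral; `conj (g t) = g t`). [folklore] -/
theorem conj_weilMellin_of_real {g : ℝ → ℂ} (hreal : ∀ t : ℝ, (g t).im = 0) (s : ℂ) :
    conj (weilMellin g s) = weilMellin g (conj s) := by
  rw [weilMellin, weilMellin, ← integral_conj]
  refine integral_congr_ae (Eventually.of_forall fun t ↦ ?_)
  simp only [map_mul, ← Complex.exp_conj, map_sub, map_div₀, map_one, map_ofNat,
    Complex.conj_ofReal, Complex.conj_eq_iff_im.2 (hreal t)]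

/-- For an odd real-valued `g` the zero-side coefficient is MINUS a square:
`P_g(ρ) = ĝ(ρ) conj ĝ(1 - ρ̄) = ĝ(ρ) conj (-ĝ(ρ̄)) = -ĝ(ρ)²`. [folklore] -/
theorem pairCoeff_of_odd_real {g : ℝ → ℂ} (hodd : ∀ t : ℝ, g (-t) = -g t)
    (hreal : ∀ t : ℝ, (g t).im = 0) (ρ : ℂ) :
    WeilConverse.pairCoeff g ρ = -(weilMellin g ρ * weilMellin g ρ) := by
  rw [WeilConverse.pairCoeff, weilMellin_one_sub_of_odd hodd, ← conj_weilMellin_of_real hreal, map_neg,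
    Complex.conj_conj, mul_neg]

/-- **Reflection symmetry of the pairing, odd case.** For an odd `g`, `P_g(1 - ρ) = P_g(ρ)`:
both equal `-ĝ(ρ) conj ĝ(ρ̄)` by `weilMellin_one_sub_of_odd` (the two signs cancel). [folklore] -/
theorem pairCoeff_one_sub_of_odd {g : ℝ → ℂ} (hodd : ∀ t : ℝ, g (-t) = -g t) (ρ : ℂ) :
    WeilConverse.pairCoeff g (1 - ρ) = WeilConverse.pairCoeff g ρ := by
  have h1 : 1 - conj (1 - ρ) = conj ρ := by simp
  rw [WeilConverse.pairCoeff, WeilConverse.pairCoeff, h1, weilMellin_one_sub_of_odd hodd ρ,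
    weilMellin_one_sub_of_odd hodd (conj ρ), map_neg]
  ring

/-- **`B_g` is even for odd `g`.** Re-index `B_g(-y)` by the involution `ρ ↦ 1 - ρ` of the non-trivial
zeros (`one_sub_conj_mem` ∘ `conj_mem`; `Function.Involutive.toPerm`, `Equiv.tsum_eq`): multiplicities agree
(`riemannZetaZeroOrder_one_sub_holds`), the pairings agree (`pairCoeff_one_sub_of_odd`), and
`((1-ρ) - 1/2)(-y) = (ρ - 1/2)y`. [folklore] -/
theorem expSum_neg_of_odd {g : ℝ → ℂ} (hodd : ∀ t : ℝ, g (-t) = -g t) (y : ℝ) :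
    WeilConverse.expSum g (-y) = WeilConverse.expSum g y := by
  -- adapted from `expSum_neg_of_even` (…StubEvenExpSum.lean)
  have hinv : Function.Involutive fun ρ : ZetaZeros.riemannZetaNontrivialZeros ↦
      (⟨1 - (ρ : ℂ), by
        simpa using ZetaZeros.riemannZetaNontrivialZeros.conj_mem
          (ZetaZeros.riemannZetaNontrivialZeros.one_sub_conj_mem ρ.2)⟩ :
        ZetaZeros.riemannZetaNontrivialZeros) :=
    fun ρ ↦ Subtype.ext (by simp)
  rw [WeilConverse.expSum, WeilConverse.expSum, ← Equiv.tsum_eq (hinv.toPerm _)]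
  refine tsum_congr fun σ ↦ ?_
  have h0 := ZetaZeros.riemannZetaNontrivialZeros.re_pos σ.2
  have h1 := ZetaZeros.riemannZetaNontrivialZeros.re_lt_one σ.2
  have hm : riemannZetaZeroOrder (1 - (σ : ℂ)) = riemannZetaZeroOrder (σ : ℂ) :=
    riemannZetaZeroOrder_one_sub_holds h0 h1
  have hE : cexp ((1 - (σ : ℂ) - 1 / 2) * ((-y : ℝ) : ℂ)) = cexp (((σ : ℂ) - 1 / 2) * (y : ℂ)) := by
    congr 1
    push_cast
    ring
  show (riemannZetaZeroOrder (1 - (σ : ℂ)) : ℂ) * WeilConverse.pairCoeff g (1 - (σ : ℂ)) *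
      cexp ((1 - (σ : ℂ) - 1 / 2) * ((-y : ℝ) : ℂ)) = _
  rw [hm, pairCoeff_one_sub_of_odd hodd, hE]

/-- **`B_g` is real for odd `g`**: `conj B_g(y) = B_g(-y)` (`conj_expSum_eq_expSum_neg`, valid for every
`g`) `= B_g(y)` (`expSum_neg_of_odd`). [folklore] -/
theorem expSum_im_of_odd {g : ℝ → ℂ} (hodd : ∀ t : ℝ, g (-t) = -g t) (y : ℝ) :
    (WeilConverse.expSum g y).im = 0 := by
  rw [← Complex.conj_eq_iff_im, conj_expSum_eq_expSum_neg, expSum_neg_of_odd hodd]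

/-- The symmetric translate of an odd function is odd. [folklore] -/
theorem symTranslate_odd {g : ℝ → ℂ} (hodd : ∀ t : ℝ, g (-t) = -g t) (x t : ℝ) :
    (g (-t - x) + g (-t + x)) / 2 = -((g (t - x) + g (t + x)) / 2) := by
  rw [show -t - x = -(t + x) by ring, show -t + x = -(t - x) by ring, hodd, hodd]
  ring

/-- **The one-sided bound, odd sector.** Under the odd-sector bet, for an odd real-valued test function
`g` and every real `x`: `-Re Q₀(g) ≤ Re B_g(x)`.  Indeed `h = h_{x/2}` is an odd real test function, so
`0 ≤ Re W(h ⋆ h̃) = Re Q₀(h) = (Re B_g(x) + Re Q₀(g))/2`, where `Q₀(h) = W(h ⋆ h̃)` because both are the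
limit of the symmetric partial zero sums of `h ⋆ h̃` (`WeilConverse.hasWeilZeroSide_zeroForm` and the
proved explicit formula `explicit_formula_holds`). [folklore] -/
theorem oddSector_lowerBound
    (hB : ∀ g : ℝ → ℂ, IsWeilTest g → (∀ t : ℝ, g (-t) = -g t) → (∀ t : ℝ, (g t).im = 0) →
      0 ≤ (weilQuadratic g).re)
    {g : ℝ → ℂ} (hg : IsWeilTest g) (hodd : ∀ t : ℝ, g (-t) = -g t)
    (hreal : ∀ t : ℝ, (g t).im = 0) (x : ℝ) :
    -(WeilConverse.zeroForm g).re ≤ (WeilConverse.expSum g x).re := by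
  -- adapted from `stub_evenTransfer_lowerBound` (…StubEvenTransfer.lean)
  have hh := isWeilTest_symTranslate hg (x / 2)
  have h0 := hB _ hh (fun t ↦ symTranslate_odd hodd (x / 2) t) (fun t ↦ symTranslate_im hreal (x / 2) t)
  -- `Q₀(h) = W(h ⋆ h̃)`
  have hQW : WeilConverse.zeroForm _ = weilQuadratic _ :=
    tendsto_nhds_unique (WeilConverse.hasWeilZeroSide_zeroForm hh)
      (explicit_formula_holds (hh.weilConv hh.weilReflect))
  rw [← hQW, zeroForm_symTranslate hg, show 2 * (x / 2) = x by ring, Complex.div_ofNat_re,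
    Complex.add_re, Complex.ofReal_re] at h0
  linarith

/-- **`ĝ` vanishes at every off-line non-trivial zero, for every odd real test `g`** (under the
odd-sector bet).  `B_g` is real (`expSum_im_of_odd`) with `Re B_g ≥ -Re Q₀(g)` (`oddSector_lowerBound`),
so THE ENGINE (`stub_evenEngine` via `stub_evenTransfer_order_mul_pairCoeff_eq_zero`) gives
`m(ρ) P_g(ρ) = 0` for `Re ρ > 1/2`; as `m(ρ) ≥ 1` and `P_g(ρ) = -ĝ(ρ)²`, `ĝ(ρ) = 0` there.  For
`Re ρ < 1/2`, `1 - ρ̄` is a non-trivial zero with `Re > 1/2` and `ĝ(1 - ρ̄) = -conj ĝ(ρ)`. [folklore] -/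
theorem oddSector_weilMellin_eq_zero
    (hB : ∀ g : ℝ → ℂ, IsWeilTest g → (∀ t : ℝ, g (-t) = -g t) → (∀ t : ℝ, (g t).im = 0) →
      0 ≤ (weilQuadratic g).re)
    {g : ℝ → ℂ} (hg : IsWeilTest g) (hodd : ∀ t : ℝ, g (-t) = -g t)
    (hreal : ∀ t : ℝ, (g t).im = 0) {ρ : ℂ} (hρ : ρ ∈ ZetaZeros.riemannZetaNontrivialZeros)
    (hre : ρ.re ≠ 1 / 2) : weilMellin g ρ = 0 := by
  -- adapted from `stub_evenTransfer_weilMellin_eq_zero` (…StubEvenTransfer.lean)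
  have hBreal : ∀ x : ℝ, (WeilConverse.expSum g x).im = 0 := fun x ↦ expSum_im_of_odd hodd x
  have hbound : ∀ x : ℝ, -(WeilConverse.zeroForm g).re ≤ (WeilConverse.expSum g x).re :=
    oddSector_lowerBound hB hg hodd hreal
  -- zeros to the right of the critical line
  have key : ∀ ρ : ℂ, ρ ∈ ZetaZeros.riemannZetaNontrivialZeros → 1 / 2 < ρ.re →
      weilMellin g ρ = 0 := by
    intro ρ hρ hgt
    have h := stub_evenTransfer_order_mul_pairCoeff_eq_zero stub_evenEngine hg hBreal hbound hρ hgt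
    have hm : (riemannZetaZeroOrder ρ : ℂ) ≠ 0 := by
      have := ZetaZeros.riemannZetaNontrivialZeros.one_le_order hρ
      exact_mod_cast (by omega : riemannZetaZeroOrder ρ ≠ 0)
    rw [pairCoeff_of_odd_real hodd hreal, mul_eq_zero, or_iff_right hm, neg_eq_zero] at h
    exact mul_self_eq_zero.1 h
  rcases hre.lt_or_gt with hlt | hgt
  · -- zeros to the left reflect to the right: `ĝ(1 - ρ̄) = -conj ĝ(ρ) = 0`
    have h1 := key (1 - conj ρ) (ZetaZeros.riemannZetaNontrivialZeros.one_sub_conj_mem hρ)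
      (by rw [WeilConverse.one_sub_conj_re]; linarith)
    rwa [weilMellin_one_sub_of_odd hodd, ← conj_weilMellin_of_real hreal, neg_eq_zero,
      map_eq_zero] at h1
  · exact key ρ hρ hgt

/-- **An odd real test function seen by a given point `ρ ≠ 1/2`.**  Take the even real-valued test
function `g₀` of `stub_evenTestExists ρ` (`ĝ₀(ρ) ≠ 0`) and differentiate: `g₀'` is a test function
(`IsWeilTest.deriv`), odd (`deriv_comp_neg`), real-valued (`deriv.star`), and
`(g₀')^(ρ) = -(ρ - 1/2) ĝ₀(ρ) ≠ 0` (`weilMellin_deriv`). [folklore] -/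
theorem exists_odd_real_isWeilTest_weilMellin_ne_zero {ρ : ℂ} (hρ : ρ ≠ 1 / 2) :
    ∃ g : ℝ → ℂ, IsWeilTest g ∧ (∀ t : ℝ, g (-t) = -g t) ∧ (∀ t : ℝ, (g t).im = 0) ∧
      weilMellin g ρ ≠ 0 := by
  obtain ⟨g, hg, heven, hreal, hg0⟩ := stub_evenTestExists ρ
  refine ⟨deriv g, hg.deriv, fun t ↦ ?_, fun t ↦ ?_, ?_⟩
  · -- the derivative of an even function is odd
    have hfun : (fun x ↦ g (-x)) = g := funext heven
    have h := deriv_comp_neg g t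
    rw [hfun] at h
    rw [h, neg_neg]
  · -- the derivative of a real-valued function is real-valued
    have hfun : (fun y ↦ star (g y)) = g := funext fun y ↦ Complex.conj_eq_iff_im.2 (hreal y)
    have h : deriv (fun y ↦ star (g y)) t = star (deriv g t) := deriv.star
    rw [hfun] at h
    exact Complex.conj_eq_iff_im.1 h.symm
  · rw [weilMellin_deriv hg]
    exact mul_ne_zero (neg_ne_zero.2 (sub_ne_zero.2 hρ)) hg0

/-- **Stub `stub_oddSectorCriterion` of line `SketchIdeator1` — the odd-sector Weil criterion
(registered signature).**  Weil positivity `0 ≤ Re W(g ⋆ g̃)` on the ODD real-valued test functions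
⟹ every zero of `ζ` in the open critical strip lies on the critical line (or on the real axis).  Given a
zero `s` with `0 < Re s < 1` (a non-trivial zero, `mem_iff'`) and `Re s ≠ 1/2` (so `s ≠ 1/2`),
`exists_odd_real_isWeilTest_weilMellin_ne_zero` supplies an odd real test `g` with `ĝ(s) ≠ 0`,
contradicting `oddSector_weilMellin_eq_zero`. -/
theorem stub_oddSectorCriterion :
    (∀ g : ℝ → ℂ, IsWeilTest g → (∀ t : ℝ, g (-t) = -g t) → (∀ t : ℝ, (g t).im = 0) → 0 ≤ (weilQuadratic g).re) →
    ∀ s : ℂ, riemannZeta s = 0 → 0 < s.re → s.re < 1 → s.re = 1 / 2 ∨ s.im = 0 := by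
  intro hB s hs h0 h1
  have hmem : s ∈ ZetaZeros.riemannZetaNontrivialZeros :=
    ZetaZeros.riemannZetaNontrivialZeros.mem_iff'.2 ⟨hs, h0, h1⟩
  refine Or.inl ?_
  by_contra hne
  have hs' : s ≠ 1 / 2 := by
    rintro rfl
    exact hne (by simp)
  obtain ⟨g, hg, hodd, hreal, hg0⟩ := exists_odd_real_isWeilTest_weilMellin_ne_zero hs'
  exact hg0 (oddSector_weilMellin_eq_zero hB hg hodd hreal hmem hne)

end Summit.RiemannHypothesis.RiemannHypothesis.Theorems.RuelleBandExactFirstBand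
end
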